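import Literature.Geometry.Lorentzian.KerrIngoingCoordMetric
import HarnessLib

/-!
# The Boyer–Lindquist slice of Kerr in ingoing Kerr coordinates: the induced metric is the
# Boyer–Lindquist 3-metric

Support file (all results proved; the definitions are explicit closed-form expressions, no named
facts). In Kerr's ingoing coordinates `u = (t*, r, μ, φ)` of the tree
(`KerrIngoingCoordMetric.lean`: `g = Kerr.Ingoing.bilin M a u`, rational in `(r, μ)`; identified
with the pull-back of the Kerr–Schild form in `KerrIngoingCoordPullback.lean`) the Boyer–Lindquist
time and azimuth are `t = t* + r − r*(r)`, `φ_BL = φ − φ♯(r)` with `dr*/dr = (r² + a²)/Δ`,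
`dφ♯/dr = a/Δ`, `Δ = r² − 2Mr + a²`. Hence the **Boyer–Lindquist slice** `{t = 0}` is the graph
`t* = F(r)` with `F′ = 2Mr/Δ` (the Boyer–Lindquist slope of `BentHeight.lean`), and its natural
coordinates `(r, μ, φ_BL)` lift the slice tangent vector `(ṙ, μ̇, φ̇)` to the ingoing 4-vector

  `blLift M a r (ṙ, μ̇, φ̇) = (F′ ṙ, ṙ, μ̇, φ̇ + (a/Δ) ṙ)`   (`Kerr.Ingoing.blLift`).

**Main result** (`Kerr.Ingoing.bilin_blLift`): for `Δ ≠ 0`, `Σ ≠ 0`,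

  `g_u(blLift v, blLift w) = (Σ/Δ) ṙ₁ṙ₂ + c₂₂ μ̇₁μ̇₂ + (A/Σ)(1 − μ²) φ̇₁φ̇₂`,
  `A = (r² + a²)Σ + 2Mr a²(1 − μ²)` (`= (r² + a²)² − Δ a² sin²θ`, `Kerr.Ingoing.blA`),

i.e. **the induced metric of the Boyer–Lindquist slice is the Boyer–Lindquist 3-metric**
`h_BL = (Σ/Δ) dr² + Σ dθ² + (A/Σ) sin²θ dφ²` (`c₂₂ dμ² = Σ dθ²`): on the slice
`ℓ = (Σ/Δ) dr − a sin²θ dφ_BL` (`ell_blLift`), the `dr dφ_BL` cross terms cancel identically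
(this is what fixes `dφ♯/dr = a/Δ`), and the `dr²` coefficient is
`(Δ² − 4M²r² − 2a² sin²θ Δ + (r² + a²)a² sin²θ + 2MrΣ)/Δ² = Σ/Δ`. Two by-products used by the
quasi-isotropic re-charting of the sequel: `blA_eq` (`A = (r² + a²)² − Δ a²(1 − μ²)`) and
`bilin_blLift_radial` (the pure radial case).

This is the `a ≠ 0` analogue of the static slice of `SchwarzschildStaticLeaf.lean` (for `a = 0`,
`F′ = 2M/(r − 2M)`, the twist vanishes and `h_BL = (1 − 2M/r)⁻¹dr² + r²dΩ²`): the first step of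
the statement that the Boyer–Lindquist slice of Kerr, read in quasi-isotropic Cartesian
coordinates, is an exact Kerr leaf with Dafermos–Rodnianski admissible asymptotics.

References: Boyer–Lindquist, J. Math. Phys. 8 (1967) 265, (2.13); Visser arXiv:0706.0622, §4–§5,
(E:K1), (E:BL1)–(E:BL3) (the coordinate changes `v = t + r*`, `φ_in = φ_BL + ∫ a/Δ`); Kerr 1963,
eq. (1); Brandt–Seidel, Phys. Rev. D 54 (1996) 1403, §II (the slice `t = const` and its 3-metric).
-/

noncomputable section

open Bundle TopologicalSpace Set Module
open scoped InnerProductSpace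

namespace Literature.Geometry.Lorentzian

namespace Kerr.Ingoing

/-! ### The Boyer–Lindquist quantities `Δ`, `A`, the slopes and the lift -/

/-- The horizon function `Δ = r² − 2Mr + a²` of Kerr. Boyer–Lindquist 1967; Visser
arXiv:0706.0622, (E:BL2). [cite: arXiv07060622, §5] -/
def delta (M a r : ℝ) : ℝ :=
  r ^ 2 - 2 * M * r + a ^ 2

/-- The Boyer–Lindquist function `A = (r² + a²)Σ + 2Mr a²(1 − μ²)` in the coordinates
`u = (t*, r, μ, φ)` (`g_{φφ}^{BL} = (A/Σ) sin²θ`). Visser arXiv:0706.0622, (E:BL2)–(E:BL3).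
[cite: arXiv07060622, §5] -/
def blA (M a : ℝ) (u : E4) : ℝ :=
  (u 1 ^ 2 + a ^ 2) * sigma a u + 2 * M * u 1 * a ^ 2 * sinSq u

/-- `A = (r² + a²)² − Δ a² (1 − μ²)`. Visser arXiv:0706.0622, (E:BL3). [cite: arXiv07060622, §5] -/
theorem blA_eq (M a : ℝ) (u : E4) :
    blA M a u = (u 1 ^ 2 + a ^ 2) ^ 2 - delta M a (u 1) * a ^ 2 * sinSq u := by
  simp only [blA, delta, sigma, sinSq]
  ring

/-- **The Boyer–Lindquist slope** `F′(r) = 2Mr/Δ` of the slice `{t = 0}` as a graph `t* = F(r)`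
over the ingoing coordinates (`t = t* + r − r*`, `dr*/dr = (r² + a²)/Δ`). Visser arXiv:0706.0622,
(E:BL1); the far slope of `BentHeight.lean`. [cite: arXiv07060622, §5] -/
def blSlopeT (M a r : ℝ) : ℝ :=
  2 * M * r / delta M a r

/-- **The azimuthal twist** `dφ♯/dr = a/Δ` between the ingoing azimuth `φ` and the
Boyer–Lindquist azimuth `φ_BL = φ − φ♯(r)`. Visser arXiv:0706.0622, (E:BL1). [cite: arXiv07060622, §5] -/
def blSlopePhi (M a r : ℝ) : ℝ :=
  a / delta M a r

/-- **The lift of a slice tangent vector**: in the slice coordinates `(r, μ, φ_BL)` the tangent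
vector `(ṙ, μ̇, φ̇)` at radius `r` is the ingoing 4-vector `(F′ ṙ, ṙ, μ̇, φ̇ + (a/Δ) ṙ)`.
[cite: arXiv07060622, §5] -/
def blLift (M a r rdot mdot pdot : ℝ) : E4 :=
  WithLp.toLp 2 ![blSlopeT M a r * rdot, rdot, mdot, pdot + blSlopePhi M a r * rdot]

/-- The `t*`-component of the lift is `F′ ṙ`. [cite: arXiv07060622, §5] -/
@[simp] theorem blLift_apply_zero (M a r rdot mdot pdot : ℝ) :
    blLift M a r rdot mdot pdot 0 = blSlopeT M a r * rdot := rfl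

/-- The `r`-component of the lift is `ṙ`. [cite: arXiv07060622, §5] -/
@[simp] theorem blLift_apply_one (M a r rdot mdot pdot : ℝ) :
    blLift M a r rdot mdot pdot 1 = rdot := rfl

/-- The `μ`-component of the lift is `μ̇`. [cite: arXiv07060622, §5] -/
@[simp] theorem blLift_apply_two (M a r rdot mdot pdot : ℝ) :
    blLift M a r rdot mdot pdot 2 = mdot := rfl

/-- The `φ`-component of the lift is `φ̇ + (a/Δ) ṙ` (the twist). [cite: arXiv07060622, §5] -/
@[simp] theorem blLift_apply_three (M a r rdot mdot pdot : ℝ) :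
    blLift M a r rdot mdot pdot 3 = pdot + blSlopePhi M a r * rdot := rfl

/-! ### The Kerr–Schild covector on the slice and the induced metric -/

/-- **`ℓ` on the Boyer–Lindquist slice**: `ℓ(blLift(ṙ, μ̇, φ̇)) = (Σ/Δ) ṙ − a(1 − μ²) φ̇`, where
`ℓ = ℓ₀ − a(1 − μ²) dφ`, `ℓ₀ = dt* + dr` (`2Mr + Δ − a²(1 − μ²) = Σ`). Requires `Δ ≠ 0` at the
radius of the lift. [cite: arXiv07060622, §5] -/
theorem ell_blLift (M a : ℝ) {u : E4} (hΔ : delta M a (u 1) ≠ 0) (rdot mdot pdot : ℝ) :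
    ell0 (blLift M a (u 1) rdot mdot pdot) - a * sinSq u * blLift M a (u 1) rdot mdot pdot 3 =
      sigma a u / delta M a (u 1) * rdot - a * sinSq u * pdot := by
  set D := delta M a (u 1) with hD
  simp only [ell0_apply, blLift_apply_zero, blLift_apply_one, blLift_apply_three, blSlopeT,
    blSlopePhi]
  rw [← hD]
  field_simp
  rw [hD]
  unfold delta sigma sinSq
  ring

-- the closing `field_simp`/`ring` normalisation handles a moderately large rational expression
set_option maxHeartbeats 400000 in
/-- **The induced metric of the Boyer–Lindquist slice is the Boyer–Lindquist 3-metric.** For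
`Δ ≠ 0` and `Σ ≠ 0` at `u = (t*, r, μ, φ)`,
`g_u(blLift v, blLift w) = (Σ/Δ) ṙ₁ṙ₂ + c₂₂ μ̇₁μ̇₂ + (A/Σ)(1 − μ²) φ̇₁φ̇₂`
(`c₂₂ = Σ/(1 − μ²)`, so `c₂₂ dμ² = Σ dθ²`): `h_BL = (Σ/Δ) dr² + Σ dθ² + (A/Σ) sin²θ dφ_BL²`.
The `dr dφ_BL` cross terms cancel identically and the `dr²` coefficient collapses by
`Δ² − 4M²r² − 2a²(1−μ²)Δ + (r²+a²)a²(1−μ²) + 2MrΣ = ΣΔ`. Boyer–Lindquist 1967, (2.13); Visser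
arXiv:0706.0622, (E:BL2)–(E:BL3). [cite: arXiv07060622, §5] -/
theorem bilin_blLift (M a : ℝ) {u : E4} (hΔ : delta M a (u 1) ≠ 0) (hS : sigma a u ≠ 0)
    (rdot₁ mdot₁ pdot₁ rdot₂ mdot₂ pdot₂ : ℝ) :
    bilin M a u (blLift M a (u 1) rdot₁ mdot₁ pdot₁) (blLift M a (u 1) rdot₂ mdot₂ pdot₂) =
      sigma a u / delta M a (u 1) * (rdot₁ * rdot₂) + c22 a u * (mdot₁ * mdot₂) +
        blA M a u / sigma a u * sinSq u * (pdot₁ * pdot₂) := by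
  set D := delta M a (u 1) with hD
  set S := sigma a u with hS'
  rw [bilin_apply]
  simp only [blLift_apply_zero, blLift_apply_one, blLift_apply_two, blLift_apply_three, blSlopeT,
    blSlopePhi, c13, c33, h00, h03, scalarH, blA]
  rw [← hD, ← hS']
  field_simp
  rw [hD, hS']
  unfold delta sigma sinSq
  ring

/-- The pure radial case: `g_u(blLift(1,0,0), blLift(1,0,0)) = Σ/Δ` (`= g^{BL}_{rr}`).
[cite: arXiv07060622, §5] -/
theorem bilin_blLift_radial (M a : ℝ) {u : E4} (hΔ : delta M a (u 1) ≠ 0) (hS : sigma a u ≠ 0) :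
    bilin M a u (blLift M a (u 1) 1 0 0) (blLift M a (u 1) 1 0 0) = sigma a u / delta M a (u 1) := by
  rw [bilin_blLift M a hΔ hS]
  ring

/-- The pure azimuthal case: `g_u(∂_{φ_BL}, ∂_{φ_BL}) = (A/Σ)(1 − μ²)` (`= g^{BL}_{φφ}`; the
azimuthal Killing field is tangent to the slice, `blLift(0,0,1) = ∂_φ`). [cite: arXiv07060622, §5] -/
theorem bilin_blLift_azimuthal (M a : ℝ) {u : E4} (hΔ : delta M a (u 1) ≠ 0) (hS : sigma a u ≠ 0) :
    bilin M a u (blLift M a (u 1) 0 0 1) (blLift M a (u 1) 0 0 1) =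
      blA M a u / sigma a u * sinSq u := by
  rw [bilin_blLift M a hΔ hS]
  ring

/-- **Positivity of the Boyer–Lindquist coefficients outside the horizon function's zeros**: for
`0 ≤ M`, `0 < r`, `0 < Δ`, `−1 < μ < 1` the three coefficients `Σ/Δ`, `c₂₂`, `(A/Σ)(1 − μ²)` are
positive (`Σ ≥ r² > 0`, `A ≥ (r² + a²)Σ > 0`), so the slice is spacelike there.
Boyer–Lindquist 1967, §2. [cite: arXiv07060622, §5] -/
theorem blCoeff_pos {M a : ℝ} (hM : 0 ≤ M) {u : E4} (hr : 0 < u 1) (hΔ : 0 < delta M a (u 1))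
    (hμ₁ : -1 < u 2) (hμ₂ : u 2 < 1) :
    0 < sigma a u / delta M a (u 1) ∧ 0 < c22 a u ∧ 0 < blA M a u / sigma a u * sinSq u := by
  have hS : 0 < sigma a u := by
    unfold sigma; nlinarith [sq_nonneg (a * u 2)]
  have hP : 0 < sinSq u := by
    unfold sinSq; nlinarith
  have hA : 0 < blA M a u := by
    unfold blA
    have h1 : 0 ≤ 2 * M * u 1 * a ^ 2 * sinSq u := by positivity
    have h2 : 0 < (u 1 ^ 2 + a ^ 2) * sigma a u := by positivity
    linarith
  exact ⟨div_pos hS hΔ, div_pos hS hP, by positivity⟩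

end Kerr.Ingoing

end Literature.Geometry.Lorentzian

end
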